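import Summits.FinalStateConjecture.FinalStateConjecture.Theorems.PhotonSphereChannelsUniformPhotonSphereChannelsRMajorantRemainder

/-!
# Crux `UniformPhotonSphereChannelsR` (K1R), line `crum-peeling-recessive-tower` —
# Theorem A, rung step (A3), part 3/5: the uniform q-bound

`q_scaled_le`: by strong induction on `n`, the exact q-recursion `(Qn)` together with the remainder
bounds of part 2 gives `|q n| ρⁿ ≤ 16 ρ ω(n)`, `ω(m) = 1/(m(2λ−1+m))`, for all `n ≥ 1`, uniformly in
real `λ ≥ 2` (the pivot `(λ−1)(2λ−1+n)` absorbs the `(2λ−1) α_n` forcing and the `G₁`-shift).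
Also: the room lemma `((1+d)/τ)^(n−1) ≥ 1 + (n−1)(1−τ) + (n−1)d`, the convolution term of the
rung map, and a nine-term triangle inequality used in part 4.
-/

set_option linter.dupNamespace false

noncomputable section

namespace Summit.FinalStateConjecture.FinalStateConjecture.Theorems.CrumPeelingRecessiveTower

open Finset

/-! ### The uniform bound on `q` (Lemma Q+E merged): `|q n| ρⁿ ≤ 16 ρ ω(n)` -/

section QBound

variable {lam ρ θ : ℝ} {G q α : ℕ → ℝ}

set_option maxHeartbeats 800000 in
/-- **The q-bound.**  Under the profile hypothesis on `G`, the shift bound `|G 1| ρ ≤ θ ≤ 2⁻¹⁰`,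
`0 ≤ ρ ≤ 2⁻¹⁴`, the q-recursion (Qn) of `stub_qFormRecursion` (with `λ` real `≥ 2`), `q 1 = −Δ_λ`,
and the convolution facts (CV2)–(CV4): `|q n| ρⁿ ≤ 16 ρ/(n(2λ−1+n))` for all `n ≥ 1`. -/
theorem q_scaled_le (hlam : 2 ≤ lam) (hρ : 0 ≤ ρ) (hρle : ρ ≤ 1 / 16384)
    (hθ : |G 1| * ρ ≤ θ) (hθle : θ ≤ 1 / 1024)
    (hG : ∀ i, 2 ≤ i → |G i| * ρ ^ i ≤ 2 * ρ / (i : ℝ) ^ 2)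
    (hα1 : α 1 = -2)
    (hα : ∀ i, 2 ≤ i → α i = (1 - (i : ℝ)) * G i + 2 * ((i : ℝ) - 2) * G (i - 1))
    (hq1 : q 1 = -((2 * lam - 1) / (lam * (lam - 1))))
    (hQn : ∀ n, 2 ≤ n →
      (lam - 1) * (2 * lam - 1 + n) * q n
        = (2 * lam - 1) * α n
          - (lam - 1) * G 1 * ((n : ℝ) - 1) * q (n - 1)
          - (lam - 1) * ∑ i ∈ Finset.Ico 2 n, G i * ((n : ℝ) - i) * q (n - i)
          + 2 * (lam - 1) * (((n : ℝ) - 1) * q (n - 1) + G 1 * ((n : ℝ) - 2) * q (n - 2)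
              + ∑ i ∈ Finset.Ico 2 (n - 1), G i * ((n : ℝ) - 1 - i) * q (n - 1 - i))
          - lam * (lam - 1) * ∑ i ∈ Finset.Ico 1 n, q i * q (n - i)
          + (3 * lam - 1) * ∑ i ∈ Finset.Ico 1 n, α i * q (n - i)
          + lam * ∑ i ∈ Finset.Ico 1 (n - 1), α i * ∑ j ∈ Finset.Ico 1 (n - i), q j * q (n - i - j))
    (hCV2 : ∀ m : ℕ, 2 ≤ m → ∑ i ∈ Finset.Ico 1 m, (1 / ((i : ℝ) * (2 * lam - 1 + i)))
        * (1 / ((((m - i : ℕ) : ℝ)) * (2 * lam - 1 + ((m - i : ℕ) : ℝ))))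
      ≤ (16 / 3) * (1 / ((m : ℝ) * (2 * lam - 1 + m))) * (1 + Real.log (2 * lam)) / lam)
    (hCV3 : ∀ n : ℕ, 1 ≤ n → (n : ℝ) * ∑ i ∈ Finset.Ico 1 n, (1 / (i : ℝ))
        * (1 / ((((n - i : ℕ) : ℝ)) * (2 * lam - 1 + ((n - i : ℕ) : ℝ)))) ≤ 4)
    (hCV4 : ∀ n : ℕ, 2 ≤ n → ∑ i ∈ Finset.Ico 2 n, (1 / ((i : ℝ) ^ 2))
        * (1 / (2 * lam - 1 + ((n - i : ℕ) : ℝ))) ≤ 3 / (2 * lam - 1 + n)) :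
    ∀ n, 1 ≤ n → |q n| * ρ ^ n ≤ 16 * ρ * (1 / ((n : ℝ) * (2 * lam - 1 + n))) := by
  have hαb := alpha_scaled_le hρ hρle hα1 hα hG
  intro n
  induction n using Nat.strong_induction_on with
  | _ n ih =>
    intro hn1
    rcases Nat.lt_or_ge n 2 with hlt | hn
    · -- n = 1
      obtain rfl : n = 1 := by omega
      rw [hq1, pow_one, abs_neg]
      have hl0 : 0 < lam := by linarith
      have hl1 : 0 < lam - 1 := by linarith
      rw [abs_of_pos (div_pos (by linarith) (mul_pos hl0 hl1))]
      have hden : ((1 : ℕ) : ℝ) * (2 * lam - 1 + ((1 : ℕ) : ℝ)) = 2 * lam := by push_cast; ring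
      rw [hden]
      have hkey : (2 * lam - 1) / (lam * (lam - 1)) ≤ 16 * (1 / (2 * lam)) := by
        rw [div_le_iff₀ (mul_pos hl0 hl1)]
        rw [show 16 * (1 / (2 * lam)) * (lam * (lam - 1)) = 8 * (lam - 1) by field_simp; ring]
        linarith
      calc (2 * lam - 1) / (lam * (lam - 1)) * ρ ≤ 16 * (1 / (2 * lam)) * ρ :=
            mul_le_mul_of_nonneg_right hkey hρ
        _ = 16 * ρ * (1 / (2 * lam)) := by ring
    · -- n ≥ 2: use the recursion
      have hq' : ∀ m, 1 ≤ m → m < n →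
          |q m| * ρ ^ m ≤ 16 * ρ * (1 / ((m : ℝ) * (2 * lam - 1 + m))) :=
        fun m hm1 hmn => ih m hmn hm1
      have hnr : (2 : ℝ) ≤ n := by exact_mod_cast hn
      have hn0 : (0 : ℝ) < n := by linarith
      have hl1 : 0 < lam - 1 := by linarith
      have hl1' : 0 ≤ lam - 1 := hl1.le
      have hpiv : 0 < (lam - 1) * (2 * lam - 1 + n) := mul_pos hl1 (by linarith)
      have hθ0 : 0 ≤ θ := (mul_nonneg (abs_nonneg _) hρ).trans hθ
      have hfrac : lam * (1 / ((n : ℝ) * (2 * lam - 1 + n))) ≤ 1 / n := by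
        rw [mul_one_div, div_le_div_iff₀ (mul_pos hn0 (by linarith)) hn0]
        have h1 : (0:ℝ) ≤ (n:ℝ) * (lam - 1) := by positivity
        have h2 : (0:ℝ) ≤ (n:ℝ) ^ 2 := sq_nonneg _
        have hdiff : 1 * ((n:ℝ) * (2 * lam - 1 + n)) - lam * n = (n:ℝ) * (lam - 1) + (n:ℝ) ^ 2 := by ring
        linarith
      -- the seven pieces
      have e1 : |(2 * lam - 1) * α n| * ρ ^ n ≤ 9 * (lam - 1) * ρ / n := by
        rw [abs_mul, abs_of_pos (by linarith : (0:ℝ) < 2 * lam - 1), mul_assoc]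
        calc (2 * lam - 1) * (|α n| * ρ ^ n) ≤ (2 * lam - 1) * (3 * ρ / n) :=
              mul_le_mul_of_nonneg_left (hαb n (by omega)) (by linarith)
          _ ≤ 3 * (lam - 1) * (3 * ρ / n) := by
              apply mul_le_mul_of_nonneg_right _ (by positivity)
              linarith
          _ = 9 * (lam - 1) * ρ / n := by ring
      have e2 : |(lam - 1) * G 1 * ((n : ℝ) - 1) * q (n - 1)| * ρ ^ n ≤ 16 * (lam - 1) * θ * ρ / n := by
        have h := majorant_shift_one hρ (by omega : 1 ≤ n) ((lam - 1) * G 1 * ((n : ℝ) - 1))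
          (hq' (n - 1) (by omega) (by omega))
        have hcast : (((n - 1 : ℕ) : ℝ)) = (n : ℝ) - 1 := by rw [Nat.cast_sub (by omega)]; norm_num
        rw [hcast] at h
        refine h.trans ?_
        rw [abs_mul, abs_mul, abs_of_pos hl1, abs_of_nonneg (by linarith : (0:ℝ) ≤ (n:ℝ) - 1)]
        have h1 : 0 < (n : ℝ) - 1 := by linarith
        have h2 : 0 < 2 * lam - 1 + ((n : ℝ) - 1) := by linarith
        rw [show ρ * ((lam - 1) * |G 1| * ((n : ℝ) - 1))
              * (16 * ρ * (1 / (((n : ℝ) - 1) * (2 * lam - 1 + ((n : ℝ) - 1)))))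
            = 16 * (lam - 1) * (|G 1| * ρ) * ρ * (1 / (2 * lam - 1 + ((n : ℝ) - 1))) by
              field_simp]
        calc 16 * (lam - 1) * (|G 1| * ρ) * ρ * (1 / (2 * lam - 1 + ((n : ℝ) - 1)))
            ≤ 16 * (lam - 1) * θ * ρ * (1 / n) := by
              apply mul_le_mul _ _ (by positivity) (by positivity)
              · exact mul_le_mul_of_nonneg_right
                  (mul_le_mul_of_nonneg_left hθ (by positivity)) hρ
              · exact div_le_div_of_nonneg_left zero_le_one hn0 (by linarith)
          _ = 16 * (lam - 1) * θ * ρ / n := by ring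
      have e3 := remainder_S3 (n := n) hlam hρ hn hG hq' (hCV4 n hn)
      have e4 := remainder_S4 (n := n) (θ := θ) hlam hρ hρle hn hθ hθle hG hq'
        (fun h3 => by
          have h := hCV4 (n - 1) (by omega)
          have hcast : (((n - 1 : ℕ) : ℝ)) = (n : ℝ) - 1 := by rw [Nat.cast_sub (by omega)]; norm_num
          simpa [hcast] using h)
      have e5 := remainder_S5 (n := n) hlam hρ hn hq' (hCV2 n hn)
      have e6 := remainder_S6 (n := n) hlam hρ hn hαb hq' (hCV3 n (by omega))
      have e7 := remainder_S7 (n := n) hlam hρ hρle hn hαb hq' (fun m hm _ => hCV2 m hm) (hCV3 n (by omega))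
      -- assemble |RHS| ρ^n
      have hRHS := hQn n hn
      set S3 := ∑ i ∈ Finset.Ico 2 n, G i * ((n : ℝ) - i) * q (n - i) with hS3
      set S4 := ((n : ℝ) - 1) * q (n - 1) + G 1 * ((n : ℝ) - 2) * q (n - 2)
              + ∑ i ∈ Finset.Ico 2 (n - 1), G i * ((n : ℝ) - 1 - i) * q (n - 1 - i) with hS4
      set S5 := ∑ i ∈ Finset.Ico 1 n, q i * q (n - i) with hS5
      set S6 := ∑ i ∈ Finset.Ico 1 n, α i * q (n - i) with hS6
      set S7 := ∑ i ∈ Finset.Ico 1 (n - 1), α i * ∑ j ∈ Finset.Ico 1 (n - i), q j * q (n - i - j) with hS7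
      have hρn : 0 ≤ ρ ^ n := pow_nonneg hρ n
      have hl0 : 0 ≤ lam := by linarith
      have key : |(lam - 1) * (2 * lam - 1 + n) * q n| * ρ ^ n
          ≤ 9 * (lam - 1) * ρ / n + 16 * (lam - 1) * θ * ρ / n
            + (lam - 1) * (96 * ρ ^ 2 / n) + 2 * (lam - 1) * (17 * ρ ^ 2 / n)
            + lam * (lam - 1) * (2731 * ρ ^ 2 * (1 / ((n : ℝ) * (2 * lam - 1 + n))))
            + (3 * lam - 1) * (192 * ρ ^ 2 / n) + lam * (3 * ρ ^ 2 / n) := by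
        rw [hRHS]
        -- triangle inequality, term by term
        calc |(2 * lam - 1) * α n - (lam - 1) * G 1 * ((n:ℝ) - 1) * q (n - 1) - (lam - 1) * S3
                + 2 * (lam - 1) * S4 - lam * (lam - 1) * S5 + (3 * lam - 1) * S6 + lam * S7| * ρ ^ n
            ≤ (|(2 * lam - 1) * α n| + |(lam - 1) * G 1 * ((n:ℝ) - 1) * q (n - 1)| + (lam - 1) * |S3|
                + 2 * (lam - 1) * |S4| + lam * (lam - 1) * |S5| + (3 * lam - 1) * |S6| + lam * |S7|) * ρ ^ n := by
              apply mul_le_mul_of_nonneg_right _ hρn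
              have a1 : |(2 * lam - 1) * α n - (lam - 1) * G 1 * ((n:ℝ) - 1) * q (n - 1) - (lam - 1) * S3
                  + 2 * (lam - 1) * S4 - lam * (lam - 1) * S5 + (3 * lam - 1) * S6 + lam * S7|
                  ≤ |(2 * lam - 1) * α n| + |(lam - 1) * G 1 * ((n:ℝ) - 1) * q (n - 1)| + |(lam - 1) * S3|
                  + |2 * (lam - 1) * S4| + |lam * (lam - 1) * S5| + |(3 * lam - 1) * S6| + |lam * S7| := by
                have := abs_sub (((2 * lam - 1) * α n)) ((lam - 1) * G 1 * ((n:ℝ) - 1) * q (n - 1))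
                -- repeated abs_add / abs_sub
                calc _ ≤ |(2 * lam - 1) * α n - (lam - 1) * G 1 * ((n:ℝ) - 1) * q (n - 1) - (lam - 1) * S3
                          + 2 * (lam - 1) * S4 - lam * (lam - 1) * S5 + (3 * lam - 1) * S6| + |lam * S7| :=
                      abs_add_le _ _
                  _ ≤ |(2 * lam - 1) * α n - (lam - 1) * G 1 * ((n:ℝ) - 1) * q (n - 1) - (lam - 1) * S3
                          + 2 * (lam - 1) * S4 - lam * (lam - 1) * S5| + |(3 * lam - 1) * S6| + |lam * S7| := by
                      gcongr
                      exact abs_add_le _ _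
                  _ ≤ |(2 * lam - 1) * α n - (lam - 1) * G 1 * ((n:ℝ) - 1) * q (n - 1) - (lam - 1) * S3
                          + 2 * (lam - 1) * S4| + |lam * (lam - 1) * S5| + |(3 * lam - 1) * S6| + |lam * S7| := by
                      gcongr
                      exact abs_sub _ _
                  _ ≤ |(2 * lam - 1) * α n - (lam - 1) * G 1 * ((n:ℝ) - 1) * q (n - 1) - (lam - 1) * S3|
                          + |2 * (lam - 1) * S4| + |lam * (lam - 1) * S5| + |(3 * lam - 1) * S6| + |lam * S7| := by
                      gcongr
                      exact abs_add_le _ _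
                  _ ≤ |(2 * lam - 1) * α n - (lam - 1) * G 1 * ((n:ℝ) - 1) * q (n - 1)| + |(lam - 1) * S3|
                          + |2 * (lam - 1) * S4| + |lam * (lam - 1) * S5| + |(3 * lam - 1) * S6| + |lam * S7| := by
                      gcongr
                      exact abs_sub _ _
                  _ ≤ _ := by gcongr
              refine a1.trans (le_of_eq ?_)
              rw [abs_mul (lam - 1) S3, abs_mul (2 * (lam - 1)) S4, abs_mul (lam * (lam - 1)) S5,
                abs_mul (3 * lam - 1) S6, abs_mul lam S7, abs_of_pos hl1,
                abs_of_pos (by linarith : (0:ℝ) < 2 * (lam - 1)), abs_of_pos (mul_pos (by linarith) hl1),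
                abs_of_pos (by linarith : (0:ℝ) < 3 * lam - 1), abs_of_nonneg hl0]
          _ = |(2 * lam - 1) * α n| * ρ ^ n + |(lam - 1) * G 1 * ((n:ℝ) - 1) * q (n - 1)| * ρ ^ n
                + (lam - 1) * (|S3| * ρ ^ n) + 2 * (lam - 1) * (|S4| * ρ ^ n) + lam * (lam - 1) * (|S5| * ρ ^ n)
                + (3 * lam - 1) * (|S6| * ρ ^ n) + lam * (|S7| * ρ ^ n) := by ring
          _ ≤ _ := by
              have p3 := mul_le_mul_of_nonneg_left e3 hl1.le
              have p4 := mul_le_mul_of_nonneg_left e4 (by linarith : (0:ℝ) ≤ 2 * (lam - 1))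
              have p5 := mul_le_mul_of_nonneg_left e5 (mul_nonneg hl0 hl1.le)
              have p6 := mul_le_mul_of_nonneg_left e6 (by linarith : (0:ℝ) ≤ 3 * lam - 1)
              have p7 := mul_le_mul_of_nonneg_left e7 hl0
              linarith
      -- compare with the target `(λ-1)(2λ-1+n) · 16ρ ω(n) = 16 (λ-1) ρ / n`
      have hbig : 9 * (lam - 1) * ρ / n + 16 * (lam - 1) * θ * ρ / n
            + (lam - 1) * (96 * ρ ^ 2 / n) + 2 * (lam - 1) * (17 * ρ ^ 2 / n)
            + lam * (lam - 1) * (2731 * ρ ^ 2 * (1 / ((n : ℝ) * (2 * lam - 1 + n))))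
            + (3 * lam - 1) * (192 * ρ ^ 2 / n) + lam * (3 * ρ ^ 2 / n)
          ≤ (lam - 1) * (2 * lam - 1 + n) * (16 * ρ * (1 / ((n : ℝ) * (2 * lam - 1 + n)))) := by
        have h2n : 0 < 2 * lam - 1 + n := by linarith
        have hA1 : 1 ≤ lam - 1 := by linarith
        -- the unit `u = (λ-1) ρ / n`
        set u : ℝ := (lam - 1) * ρ / n with hu
        have hu0 : 0 ≤ u := by rw [hu]; positivity
        have hρ2 : ρ ^ 2 ≤ ρ * (1 / 16384) := by
          rw [pow_two]; exact mul_le_mul_of_nonneg_left hρle hρ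
        -- each summand against `u`
        have t1 : 9 * (lam - 1) * ρ / n = 9 * u := by rw [hu]; ring
        have t2 : 16 * (lam - 1) * θ * ρ / n ≤ (16 / 1024) * u := by
          rw [hu]
          have : 16 * (lam - 1) * θ * ρ / n = (16 * θ) * ((lam - 1) * ρ / n) := by ring
          rw [this]
          exact mul_le_mul_of_nonneg_right (by linarith) hu0
        have hρ2n : ∀ c : ℝ, 0 ≤ c → c * (ρ ^ 2 / n) ≤ c * (1 / 16384) * (ρ / n) := by
          intro c hc
          have : ρ ^ 2 / n ≤ (1 / 16384) * (ρ / n) := by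
            rw [div_le_iff₀ hn0, show (1:ℝ) / 16384 * (ρ / n) * n = ρ * (1 / 16384) by field_simp]
            exact hρ2
          calc c * (ρ ^ 2 / n) ≤ c * ((1 / 16384) * (ρ / n)) := mul_le_mul_of_nonneg_left this hc
            _ = c * (1 / 16384) * (ρ / n) := by ring
        have t3 : (lam - 1) * (96 * ρ ^ 2 / n) ≤ (96 / 16384) * u := by
          have h := hρ2n (96 * (lam - 1)) (mul_nonneg (by norm_num) hl1.le)
          rw [hu]
          calc (lam - 1) * (96 * ρ ^ 2 / n) = 96 * (lam - 1) * (ρ ^ 2 / n) := by ring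
            _ ≤ 96 * (lam - 1) * (1 / 16384) * (ρ / n) := h
            _ = 96 / 16384 * ((lam - 1) * ρ / n) := by ring
        have t4 : 2 * (lam - 1) * (17 * ρ ^ 2 / n) ≤ (34 / 16384) * u := by
          have h := hρ2n (34 * (lam - 1)) (mul_nonneg (by norm_num) hl1.le)
          rw [hu]
          calc 2 * (lam - 1) * (17 * ρ ^ 2 / n) = 34 * (lam - 1) * (ρ ^ 2 / n) := by ring
            _ ≤ 34 * (lam - 1) * (1 / 16384) * (ρ / n) := h
            _ = 34 / 16384 * ((lam - 1) * ρ / n) := by ring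
        have t5 : lam * (lam - 1) * (2731 * ρ ^ 2 * (1 / ((n : ℝ) * (2 * lam - 1 + n))))
            ≤ (2731 / 16384) * u := by
          have h := hρ2n (2731 * (lam - 1)) (mul_nonneg (by norm_num) hl1.le)
          rw [hu]
          calc lam * (lam - 1) * (2731 * ρ ^ 2 * (1 / ((n : ℝ) * (2 * lam - 1 + n))))
              = 2731 * (lam - 1) * ρ ^ 2 * (lam * (1 / ((n : ℝ) * (2 * lam - 1 + n)))) := by ring
            _ ≤ 2731 * (lam - 1) * ρ ^ 2 * (1 / n) := mul_le_mul_of_nonneg_left hfrac (by positivity)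
            _ = 2731 * (lam - 1) * (ρ ^ 2 / n) := by ring
            _ ≤ 2731 * (lam - 1) * (1 / 16384) * (ρ / n) := h
            _ = 2731 / 16384 * ((lam - 1) * ρ / n) := by ring
        have t6 : (3 * lam - 1) * (192 * ρ ^ 2 / n) ≤ (960 / 16384) * u := by
          have h := hρ2n (192 * (3 * lam - 1)) (mul_nonneg (by norm_num) (by linarith))
          have h35 : 3 * lam - 1 ≤ 5 * (lam - 1) := by linarith
          rw [hu]
          calc (3 * lam - 1) * (192 * ρ ^ 2 / n) = 192 * (3 * lam - 1) * (ρ ^ 2 / n) := by ring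
            _ ≤ 192 * (3 * lam - 1) * (1 / 16384) * (ρ / n) := h
            _ ≤ 192 * (5 * (lam - 1)) * (1 / 16384) * (ρ / n) := by
                apply mul_le_mul_of_nonneg_right _ (by positivity)
                apply mul_le_mul_of_nonneg_right _ (by norm_num)
                exact mul_le_mul_of_nonneg_left h35 (by norm_num)
            _ = 960 / 16384 * ((lam - 1) * ρ / n) := by ring
        have t7 : lam * (3 * ρ ^ 2 / n) ≤ (6 / 16384) * u := by
          have h := hρ2n (3 * lam) (mul_nonneg (by norm_num) hl0)
          have hl2 : lam ≤ 2 * (lam - 1) := by linarith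
          rw [hu]
          calc lam * (3 * ρ ^ 2 / n) = 3 * lam * (ρ ^ 2 / n) := by ring
            _ ≤ 3 * lam * (1 / 16384) * (ρ / n) := h
            _ ≤ 3 * (2 * (lam - 1)) * (1 / 16384) * (ρ / n) := by
                apply mul_le_mul_of_nonneg_right _ (by positivity)
                apply mul_le_mul_of_nonneg_right _ (by norm_num)
                exact mul_le_mul_of_nonneg_left hl2 (by norm_num)
            _ = 6 / 16384 * ((lam - 1) * ρ / n) := by ring
        have htarget : (lam - 1) * (2 * lam - 1 + n) * (16 * ρ * (1 / ((n : ℝ) * (2 * lam - 1 + n))))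
            = 16 * u := by
          rw [hu]
          have h1 : (2 * lam - 1 + (n : ℝ)) * (1 / ((n : ℝ) * (2 * lam - 1 + n))) = 1 / n := by
            rw [mul_one_div, div_eq_div_iff (by positivity) hn0.ne']
            ring
          calc (lam - 1) * (2 * lam - 1 + n) * (16 * ρ * (1 / ((n : ℝ) * (2 * lam - 1 + n))))
              = (lam - 1) * 16 * ρ * ((2 * lam - 1 + (n : ℝ)) * (1 / ((n : ℝ) * (2 * lam - 1 + n)))) := by
                ring
            _ = (lam - 1) * 16 * ρ * (1 / n) := by rw [h1]
            _ = 16 * ((lam - 1) * ρ / n) := by ring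
        rw [htarget, t1]
        linarith
      -- conclude: divide by the positive pivot
      have hprod : |q n| * ρ ^ n * ((lam - 1) * (2 * lam - 1 + n))
          ≤ (16 * ρ * (1 / ((n : ℝ) * (2 * lam - 1 + n)))) * ((lam - 1) * (2 * lam - 1 + n)) := by
        have heq : |(lam - 1) * (2 * lam - 1 + n) * q n| * ρ ^ n
            = |q n| * ρ ^ n * ((lam - 1) * (2 * lam - 1 + n)) := by
          rw [abs_mul, abs_of_pos hpiv]; ring
        have hkb := key.trans hbig
        rw [heq] at hkb
        rw [mul_comm (16 * ρ * (1 / ((n : ℝ) * (2 * lam - 1 + n))))]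
        exact hkb
      exact le_of_mul_le_mul_right hprod hpiv

end QBound

/-! ### Room, convolution term, triangle inequality -/

section Step

/-- Room from the schedule and the drift: with `τ = 1 − 2/(2λ−1)² ∈ (0,1]` and `d = Δ/B ≥ 0`,
`((1 + d)/τ)^(n-1) ≥ 1 + (n−1)·2/(2λ−1)² + (n−1) d`. -/
theorem step_room :
    ∀ {τ d s : ℝ}, 0 < τ → τ ≤ 1 → 1 - τ = s → 0 ≤ d → ∀ (n : ℕ), 1 ≤ n → 1 + ((n : ℝ) - 1) * s +
      ((n : ℝ) - 1) * d ≤ ((1 + d) / τ) ^ (n - 1) := by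
  intro τ d s hτ0 hτ1 hs hd n hn
  have hs0 : 0 ≤ s := by linarith
  have hcast : (((n - 1 : ℕ) : ℝ)) = (n : ℝ) - 1 := by rw [Nat.cast_sub hn]; norm_num
  -- Bernoulli twice
  have h1 : 1 + ((n : ℝ) - 1) * d ≤ (1 + d) ^ (n - 1) := by
    have := one_add_mul_le_pow (by linarith : (-2 : ℝ) ≤ d) (n - 1)
    rw [hcast] at this; linarith
  have hinv : 1 + s ≤ 1 / τ := by
    rw [le_div_iff₀ hτ0]
    nlinarith
  have h2 : 1 + ((n : ℝ) - 1) * s ≤ (1 / τ) ^ (n - 1) := by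
    have := one_add_mul_le_pow (by linarith : (-2 : ℝ) ≤ s) (n - 1)
    rw [hcast] at this
    exact this.trans (pow_le_pow_left₀ (by linarith) hinv _)
  have hprod : (1 + ((n : ℝ) - 1) * s) * (1 + ((n : ℝ) - 1) * d) ≤ ((1 + d) / τ) ^ (n - 1) := by
    rw [div_eq_mul_one_div, mul_pow, mul_comm]
    have hnr : (1 : ℝ) ≤ n := by exact_mod_cast hn
    exact mul_le_mul h1 h2 (by nlinarith) (pow_nonneg (by linarith) _)
  have hnr : (1 : ℝ) ≤ n := by exact_mod_cast hn
  nlinarith [mul_nonneg (mul_nonneg (by linarith : (0:ℝ) ≤ (n:ℝ) - 1) hs0)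
    (mul_nonneg (by linarith : (0:ℝ) ≤ (n:ℝ) - 1) hd)]

/-- **The convolution term of the rung map.** `|Σ_{2≤i<n} G i q (n−i)| ρⁿ ≤ 512 ρ² ω(n)`
(uses (CV1) and the q-bound). -/
theorem conv_scaled_le {lam ρ : ℝ} {G q : ℕ → ℝ} {n : ℕ} (hlam : 2 ≤ lam) (hρ0 : 0 ≤ ρ)
    (hn : 2 ≤ n) (hG : ∀ i, 2 ≤ i → |G i| * ρ ^ i ≤ 2 * ρ / (i : ℝ) ^ 2)
    (hq : ∀ m, 1 ≤ m → |q m| * ρ ^ m ≤ 16 * ρ * (1 / ((m : ℝ) * (2 * lam - 1 + m))))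
    (h3 : ∑ i ∈ Finset.Ico 2 n, (1 / ((i : ℝ) ^ 2))
        * (1 / ((((n - i : ℕ) : ℝ)) * (2 * lam - 1 + ((n - i : ℕ) : ℝ))))
      ≤ 16 * (((n : ℝ) - 1) / n) * (1 / ((n : ℝ) * (2 * lam - 1 + n)))) :
    |∑ i ∈ Finset.Ico 2 n, G i * q (n - i)| * ρ ^ n
      ≤ 512 * ρ ^ 2 * (1 / ((n : ℝ) * (2 * lam - 1 + n))) := by
  have hnr : (2 : ℝ) ≤ n := by exact_mod_cast hn
  have hn0 : (0 : ℝ) < n := by linarith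
  set ω : ℝ := 1 / ((n : ℝ) * (2 * lam - 1 + n)) with hωdef
  have hω0 : 0 < ω := omegaW_pos hlam (by omega : 1 ≤ n)
  have h1 := majorant_sum_mul hρ0 (s := Finset.Ico 2 n) (n := n) (x := G) (y := q)
    (X := fun i => 2 * ρ / (i : ℝ) ^ 2)
    (Y := fun m => 16 * ρ * (1 / ((m : ℝ) * (2 * lam - 1 + m))))
    (fun i hi => (Finset.mem_Ico.mp hi).2.le) (fun i hi => hG i (Finset.mem_Ico.mp hi).1)
    (fun i hi => hq (n - i) (by have := Finset.mem_Ico.mp hi; omega))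
  refine h1.trans ?_
  have h2 : ∑ i ∈ Finset.Ico 2 n, (fun i : ℕ => 2 * ρ / (i : ℝ) ^ 2) i
        * (fun m : ℕ => 16 * ρ * (1 / ((m : ℝ) * (2 * lam - 1 + m)))) (n - i)
      = 32 * ρ ^ 2 * ∑ i ∈ Finset.Ico 2 n, (1 / ((i : ℝ) ^ 2))
        * (1 / ((((n - i : ℕ)) : ℝ) * (2 * lam - 1 + ((n - i : ℕ) : ℝ)))) := by
    rw [Finset.mul_sum]
    exact Finset.sum_congr rfl (fun i _ => by ring)
  rw [h2]
  have h4 : ((n : ℝ) - 1) / n ≤ 1 := by rw [div_le_one hn0]; linarith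
  have h5 : 16 * (((n : ℝ) - 1) / n) * ω ≤ 16 * ω := by
    have := mul_le_mul_of_nonneg_right h4 hω0.le
    linarith
  have h6 := mul_le_mul_of_nonneg_left (h3.trans h5) (by positivity : (0:ℝ) ≤ 32 * ρ ^ 2)
  linarith

end Step

/-- Nine-term triangle inequality, multiplied by a nonnegative weight. -/
theorem abs_add_nine_mul (a b c d e f g h i r : ℝ) (hr : 0 ≤ r) :
    |a + b + c + d + e + f + g + h + i| * r
      ≤ |a| * r + |b| * r + |c| * r + |d| * r + |e| * r + |f| * r + |g| * r + |h| * r + |i| * r := by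
  have h9 : |a + b + c + d + e + f + g + h + i| ≤ |a| + |b| + |c| + |d| + |e| + |f| + |g| + |h| + |i| := by
    refine abs_le.mpr ⟨?_, ?_⟩
    · linarith [neg_abs_le a, neg_abs_le b, neg_abs_le c, neg_abs_le d, neg_abs_le e,
        neg_abs_le f, neg_abs_le g, neg_abs_le h, neg_abs_le i]
    · linarith [le_abs_self a, le_abs_self b, le_abs_self c, le_abs_self d, le_abs_self e,
        le_abs_self f, le_abs_self g, le_abs_self h, le_abs_self i]
  have := mul_le_mul_of_nonneg_right h9 hr
  linarith

end Summit.FinalStateConjecture.FinalStateConjecture.Theorems.CrumPeelingRecessiveTower
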